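import Summits.QuantumFields.BalabanUV.Beta.EriceFlowEnclosureB12AsPrintedPointwiseFadingLimit

/-!
# Beta / EriceFlowEnclosureB12AsPrintedPointwiseFadingLimitFloors — WHAT (0.31) FORCES, part 11a′: THE ASYMPTOTIC CONSTANT IS THE SUPREMUM OF THE EVENTUAL FLOORS, AND
# PRINT's TWO CONSTANTS STRADDLE IT.  Part 11 (`…PointwiseFadingLimit`) produced, under node U2's moduli `HistLipschitz ∕ FadingMemory` and NE4 `ScaleShiftRate` (0 ≤ θ < 1) alone,
# the one number `b⋆ = lim_{u→0⁺} betaInf β (u,u,…)` with the two-sided sandwich `|β_{k+1}(v) − b⋆| ≤ 2Cδ∕(1−θ) + cθ^k∕(1−θ)` on ]0, δ]^{k+1}.  Here: §1 **`isLUB_floors`** ∕ **`isGLB_ceilings`** —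
# `b⋆` is EXACTLY the least upper bound of the `b` for which node U2's letter `EventualLowerH b δ k₀ β` holds on SOME box from SOME scale, and the greatest lower bound of the eventual
# ceilings: the eventual AF letter is available for every `b < b⋆` and for no `b > b⋆` (`floor_le_bstar`, `bstar_le_ceiling`; a positive eventual floor anywhere ⟹ `b⋆ > 0`).
# §2 **`betaInf_const_bounds_of_runs`**: a family of (0.31)-runs in ]0, γ] at slopes `0 < s ≤ s′` (one per depth, relative to its own endpoint — part 10's `hruns`, i.e. what the TYPED
# Theorem 2 supplies at ONE admissible endpoint g₁ with `s = β(g₁) ln L`, `s′ = β′(g₁) ln L`) forces `s − Cδ∕(1−θ) ≤ betaInf β (δ,δ,…) ≤ s′ + Cδ∕(1−θ)` for EVERY `0 < δ ≤ γ` (no box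
# smallness), hence **`slopes_straddle_bstar`: `s ≤ b⋆ ≤ s′`** — print's two constants at ANY admissible endpoint straddle the one number (so `b⋆ > 0`, `bstar_pos_of_runs`; and across
# endpoints every lower slope is ≤ every upper slope: `sup_g β(g) ln L ≤ b⋆ ≤ inf_g β′(g) ln L`, a consistency constraint the typed (0.31) obeys under node U2's letters)
# (β-flow team, prover 2 = lower ∕ positivity side, unit `b2b-balaban-beta-bflow-p2`, gen 49; ROW AP-I × node U2's `T4BetaStationary`; kernel of part 11, second half)

HONEST FRAMING (page 1 of everything the β sub-cell writes): discharging `BetaPertH` makes Bałaban's UV stability UNCONDITIONAL — a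
real constructive-QFT result; it is NOT the continuum limit and NOT the Clay problem.  HONEST DEPENDENCY (cell reorg 2026-08-19,
verbatim): «continuum YM on T⁴ ⇐ BetaPertH ∧ nine spine estimates (0/9 proved); BetaPertH ⇐ (D1) ∧ (D4) ∧ CAP+tail; G-an2-4 gates
asym, D1 and NE2/3/4.»  THIS MODULE DISCHARGES NOTHING: [folklore] limit ∕ finite-sum calculus for an ABSTRACT `β : FlowStep.HBeta` under node U2's HYPOTHESIS SHAPES
`T4CouplingMatching.HistLipschitz ∕ FadingMemory ∕ ScaleShiftRate ∕ EventualLowerH` (NONE printed — [Balaban1987RG1] = T. Bałaban, Commun. Math. Phys. **109** (1987) p. 298 ∕ p. 264;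
GAPS G-t4-U2-1 ∕ G-t4-U2-2) and, in §2, a displayed family of runs of (0.20) p. 256 with the discrete two-sided (0.31) p. 259 (`Step.Discrete031`) — exactly part 10's `hruns`.
Node U2's `T4BetaStationary.tendsto_betaInf` and part 10's `constDrift_of_runs` are used BY NAME; nothing of theirs is restated or modified.  `b⋆` is carried as a real number with its
defining property displayed (`hb`, part 11's `exists_bstar`).  Nothing is asserted about Bałaban's β-functions (1.22), their sign, floor, moduli or scale-shift rate.

WHAT THIS FILE PROVES (0 sorry, 0 def):
§1 **`floor_le_bstar`**, **`bstar_le_ceiling`**, `bstar_pos_of_eventualLowerH`, **`isLUB_floors`**, **`isGLB_ceilings`**.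
§2 `le_of_sq_windows`, `le_of_forall_geom` (Cesàro helpers), **`betaInf_const_bounds_of_runs`**, **`slopes_straddle_bstar`** (`s ≤ b⋆ ≤ s′`), `bstar_pos_of_runs`.
NOT CLAIMED: any floor, sign, modulus or scale-shift rate for Bałaban's β; which reading print intends; Theorem 2; `BetaPertH`; continuum; Clay.
-/

namespace Summit.QuantumFields.BalabanUV.Beta.EriceFlowEnclosureB12AsPrintedPointwiseFadingLimitFloors

open Finset Filter Topology
open Literature.MathematicalPhysics.QuantumFieldTheory.Balaban1983to89
open Literature.MathematicalPhysics.QuantumFieldTheory.Balaban1983to89.FlowStep (HBeta prefixOf Box mem_box box_mono RGEqH)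
open Literature.MathematicalPhysics.QuantumFieldTheory.Balaban1983to89.T4CouplingMatching (HistLipschitz FadingMemory ScaleShiftRate
  EventualLowerH)
open Literature.MathematicalPhysics.QuantumFieldTheory.Balaban1983to89.T4BetaStationary (SeqBox revHist betaInf tendsto_betaInf
  abs_beta_revHist_sub_betaInf_le constant_nonneg_of_scaleShiftRate)
open Summit.QuantumFields.BalabanUV.Beta.EriceFlowEnclosureB12AsPrintedPointwiseFadingDrift (constDrift_of_runs)
open Summit.QuantumFields.BalabanUV.Beta.EriceFlowEnclosureB12AsPrintedPointwiseFadingLimit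

noncomputable section

variable {β : HBeta} {γ C c θ : ℝ} {Λ : ℕ → ℕ → ℝ}


/-! ## §1 `b⋆` is the supremum of the eventual floors and the infimum of the eventual ceilings near zero -/

/-- **EVERY EVENTUAL FLOOR IS ≤ b⋆.**  NE4 (θ < 1), `b⋆` the asymptotic constant (`hb`, 0 ≤ C), and node U2's letter `EventualLowerH b δ k₀ β` on some box `0 < δ ≤ γ` ⟹ `b ≤ b⋆`
(along the constant history `(u,u,…)`, u ≤ δ, the floor passes to `betaInf β (u,u,…) ≤ b⋆ + Cu∕(1−θ)`; u → 0⁺). [folklore] -/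
theorem floor_le_bstar (hS : ScaleShiftRate c θ γ β) (hθ1 : θ < 1) (hC : 0 ≤ C) {bstar : ℝ}
    (hb : ∀ u : ℝ, 0 < u → u ≤ γ → |betaInf β (fun _ : ℕ => u) - bstar| ≤ C * u / (1 - θ))
    {b δ : ℝ} {k₀ : ℕ} (hδ : 0 < δ) (hδγ : δ ≤ γ) (hfl : EventualLowerH b δ k₀ β) : b ≤ bstar := by
  have h1θ : 0 < 1 - θ := by linarith
  have hu : ∀ u : ℝ, 0 < u → u ≤ δ → b ≤ bstar + C * u / (1 - θ) := by
    intro u hu huδ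
    have huγ : u ≤ γ := huδ.trans hδγ
    have hlim : b ≤ betaInf β (fun _ : ℕ => u) :=
      ge_of_tendsto (tendsto_betaInf hS hθ1 (seqBox_const hu huγ))
        (eventually_atTop.2 ⟨k₀, fun k hk => hfl k _ hk (mem_box.mpr fun _ => ⟨hu, huδ⟩)⟩)
    have := (abs_le.mp (hb u hu huγ)).2
    linarith
  refine le_of_forall_pos_le_add fun ε hε => ?_
  set u : ℝ := min δ (ε * (1 - θ) / (C + 1)) with hudef
  have hu0 : 0 < u := lt_min hδ (by positivity)
  have huδ : u ≤ δ := min_le_left _ _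
  have huε : C * u / (1 - θ) ≤ ε := by
    have h1 : u ≤ ε * (1 - θ) / (C + 1) := min_le_right _ _
    have h2 : (C + 1) * u ≤ ε * (1 - θ) := by rwa [le_div_iff₀ (by positivity), mul_comm] at h1
    rw [div_le_iff₀ h1θ]
    nlinarith [hu0.le]
  linarith [hu u hu0 huδ]

/-- **EVERY EVENTUAL CEILING IS ≥ b⋆** (same route along the constant histories). [folklore] -/
theorem bstar_le_ceiling (hS : ScaleShiftRate c θ γ β) (hθ1 : θ < 1) (hC : 0 ≤ C) {bstar : ℝ}
    (hb : ∀ u : ℝ, 0 < u → u ≤ γ → |betaInf β (fun _ : ℕ => u) - bstar| ≤ C * u / (1 - θ))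
    {b' δ : ℝ} {k₀ : ℕ} (hδ : 0 < δ) (hδγ : δ ≤ γ)
    (hce : ∀ (k : ℕ) (v : Fin (k + 1) → ℝ), k₀ ≤ k → v ∈ Box δ k → β k v ≤ b') : bstar ≤ b' := by
  have h1θ : 0 < 1 - θ := by linarith
  have hu : ∀ u : ℝ, 0 < u → u ≤ δ → bstar ≤ b' + C * u / (1 - θ) := by
    intro u hu huδ
    have huγ : u ≤ γ := huδ.trans hδγ
    have hlim : betaInf β (fun _ : ℕ => u) ≤ b' :=
      le_of_tendsto (tendsto_betaInf hS hθ1 (seqBox_const hu huγ))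
        (eventually_atTop.2 ⟨k₀, fun k hk => hce k _ hk (mem_box.mpr fun _ => ⟨hu, huδ⟩)⟩)
    have := (abs_le.mp (hb u hu huγ)).1
    linarith
  refine le_of_forall_pos_le_add fun ε hε => ?_
  set u : ℝ := min δ (ε * (1 - θ) / (C + 1)) with hudef
  have hu0 : 0 < u := lt_min hδ (by positivity)
  have huδ : u ≤ δ := min_le_left _ _
  have huε : C * u / (1 - θ) ≤ ε := by
    have h1 : u ≤ ε * (1 - θ) / (C + 1) := min_le_right _ _
    have h2 : (C + 1) * u ≤ ε * (1 - θ) := by rwa [le_div_iff₀ (by positivity), mul_comm] at h1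
    rw [div_le_iff₀ h1θ]
    nlinarith [hu0.le]
  linarith [hu u hu0 huδ]

/-- A POSITIVE eventual floor on some box (the letter part 10b derives from the typed Theorem 2) makes `b⋆ > 0`. [folklore] -/
theorem bstar_pos_of_eventualLowerH (hS : ScaleShiftRate c θ γ β) (hθ1 : θ < 1) (hC : 0 ≤ C) {bstar : ℝ}
    (hb : ∀ u : ℝ, 0 < u → u ≤ γ → |betaInf β (fun _ : ℕ => u) - bstar| ≤ C * u / (1 - θ))
    {b δ : ℝ} {k₀ : ℕ} (hδ : 0 < δ) (hδγ : δ ≤ γ) (hfl : EventualLowerH b δ k₀ β) (hbpos : 0 < b) : 0 < bstar :=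
  hbpos.trans_le (floor_le_bstar hS hθ1 hC hb hδ hδγ hfl)

/-- **`b⋆` IS THE SUPREMUM OF THE EVENTUAL FLOORS NEAR ZERO**: the set of all `b` for which node U2's letter `EventualLowerH b δ k₀ β` holds on SOME box `0 < δ ≤ γ` from SOME scale has least
upper bound `b⋆` (upper bound: `floor_le_bstar`; approached: `eventualLowerH_bstar` with margins → 0). [folklore] -/
theorem isLUB_floors (hL : HistLipschitz Λ γ β) (hΛ : FadingMemory C θ Λ) (hS : ScaleShiftRate c θ γ β)
    (hθ0 : 0 ≤ θ) (hθ1 : θ < 1) (hC : 0 ≤ C) (hγ : 0 < γ) {bstar : ℝ}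
    (hb : ∀ u : ℝ, 0 < u → u ≤ γ → |betaInf β (fun _ : ℕ => u) - bstar| ≤ C * u / (1 - θ)) :
    IsLUB {b : ℝ | ∃ δ : ℝ, 0 < δ ∧ δ ≤ γ ∧ ∃ k₀ : ℕ, EventualLowerH b δ k₀ β} bstar := by
  refine ⟨fun b ⟨δ, hδ, hδγ, k₀, hfl⟩ => floor_le_bstar hS hθ1 hC hb hδ hδγ hfl, fun x hx => ?_⟩
  -- every upper bound x of the floors is ≥ b⋆ − ε for every ε
  refine le_of_forall_pos_le_add fun ε hε => ?_
  obtain ⟨δ, hδ, hδγ, k₀, hk⟩ := exists_sandwich hL hΛ hS hθ0 hθ1 hC hγ hb hε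
  have hmem : bstar - ε ∈ {b : ℝ | ∃ δ : ℝ, 0 < δ ∧ δ ≤ γ ∧ ∃ k₀ : ℕ, EventualLowerH b δ k₀ β} :=
    ⟨δ, hδ, hδγ, k₀, fun k v hkk hv => by have := (abs_le.mp (hk k v hkk hv)).1; linarith⟩
  linarith [hx hmem]

/-- **`b⋆` IS THE INFIMUM OF THE EVENTUAL CEILINGS NEAR ZERO.** [folklore] -/
theorem isGLB_ceilings (hL : HistLipschitz Λ γ β) (hΛ : FadingMemory C θ Λ) (hS : ScaleShiftRate c θ γ β)
    (hθ0 : 0 ≤ θ) (hθ1 : θ < 1) (hC : 0 ≤ C) (hγ : 0 < γ) {bstar : ℝ}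
    (hb : ∀ u : ℝ, 0 < u → u ≤ γ → |betaInf β (fun _ : ℕ => u) - bstar| ≤ C * u / (1 - θ)) :
    IsGLB {b' : ℝ | ∃ δ : ℝ, 0 < δ ∧ δ ≤ γ ∧ ∃ k₀ : ℕ, ∀ (k : ℕ) (v : Fin (k + 1) → ℝ), k₀ ≤ k → v ∈ Box δ k → β k v ≤ b'} bstar := by
  refine ⟨fun b' ⟨δ, hδ, hδγ, k₀, hce⟩ => bstar_le_ceiling hS hθ1 hC hb hδ hδγ hce, fun x hx => ?_⟩
  -- every lower bound x of the ceilings is ≤ b⋆ + ε for every ε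
  refine le_of_forall_pos_le_add fun ε hε => ?_
  obtain ⟨δ, hδ, hδγ, k₀, hk⟩ := exists_sandwich hL hΛ hS hθ0 hθ1 hC hγ hb hε
  have hmem : bstar + ε ∈ {b' : ℝ | ∃ δ : ℝ, 0 < δ ∧ δ ≤ γ ∧ ∃ k₀ : ℕ, ∀ (k : ℕ) (v : Fin (k + 1) → ℝ),
      k₀ ≤ k → v ∈ Box δ k → β k v ≤ b'} :=
    ⟨δ, hδ, hδγ, k₀, fun k v hkk hv => by have := (abs_le.mp (hk k v hkk hv)).2; linarith⟩
  linarith [hx hmem]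

/-! ## §2 A family of (0.31)-runs pins `b⋆` between its slopes: `s ≤ b⋆ ≤ s′` -/

/-- Cesàro helper: if `x·M² ≤ y·M² + A·M + B` for every `M ≥ 1` (A, B ≥ 0) then `x ≤ y`. [folklore] -/
theorem le_of_sq_windows {x y A B : ℝ} (hA : 0 ≤ A) (hB : 0 ≤ B)
    (h : ∀ M : ℕ, 1 ≤ M → x * ((M : ℝ) * M) ≤ y * ((M : ℝ) * M) + A * M + B) : x ≤ y := by
  refine le_of_forall_pos_le_add fun ε hε => ?_
  obtain ⟨M, hMε⟩ := exists_nat_gt ((A + B) / ε)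
  have hM1 : 1 ≤ M := by
    rcases Nat.eq_zero_or_pos M with h0 | hpos
    · rw [h0, Nat.cast_zero] at hMε
      have : 0 ≤ (A + B) / ε := by positivity
      linarith
    · exact hpos
  have hMpos : (0 : ℝ) < M := by exact_mod_cast hM1
  have hM1' : (1 : ℝ) ≤ M := by exact_mod_cast hM1
  have hAB : A * M + B ≤ ε * ((M : ℝ) * M) := by
    have h1 : A + B < ε * M := by
      have := (div_lt_iff₀ hε).mp hMε; linarith
    have h2 : B ≤ B * M := le_mul_of_one_le_right hB hM1'
    nlinarith
  have key : x * ((M : ℝ) * M) ≤ (y + ε) * ((M : ℝ) * M) := by nlinarith [h M hM1]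
  exact le_of_mul_le_mul_right key (by positivity)

/-- Geometric helper: if `x ≤ y + cθ^k∕(1−θ)` for every k (θ ∈ [0, 1[) then `x ≤ y`. [folklore] -/
theorem le_of_forall_geom {x y c θ : ℝ} (hθ0 : 0 ≤ θ) (hθ1 : θ < 1) (h : ∀ k : ℕ, x ≤ y + c * θ ^ k / (1 - θ)) : x ≤ y := by
  have ht : Tendsto (fun k : ℕ => y + c * θ ^ k / (1 - θ)) atTop (𝓝 (y + c * 0 / (1 - θ))) :=
    tendsto_const_nhds.add (((tendsto_pow_atTop_nhds_zero_of_lt_one hθ0 hθ1).const_mul c).div_const _)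
  rw [mul_zero, zero_div, add_zero] at ht
  exact ge_of_tendsto' ht h

/-- **A FAMILY OF (0.31)-RUNS PINS THE STATIONARY FUNCTIONAL ON THE CONSTANT HISTORIES.**  Node U2's moduli + NE4 (0 ≤ θ < 1, 0 ≤ C), `0 < δ ≤ γ`, and for every depth K a run of (0.20) inside
]0, γ] obeying the discrete two-sided (0.31) at slopes `0 < s ≤ s′` relative to its own endpoint (part 10's `hruns`) ⟹
`s − Cδ∕(1−θ) ≤ betaInf β (δ, δ, …) ≤ s′ + Cδ∕(1−θ)`: part 10's two-sided drift of the windows `Σ_{j∈[k,k+N)} β_{j+1}(δ,…,δ)` (defect `(Cδ∕(1−θ))N + A√N + B`) against NE4's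
`|β_{j+1}(δ,…,δ) − betaInf β (δ,…)| ≤ cθ^k∕(1−θ)` for j ≥ k; N = M² → ∞, then k → ∞.  NO box smallness is needed. [cite: Balaban1987RG1, Thm 2 (0.31) p.259 with (0.20) p.256 and §5 p.298] -/
theorem betaInf_const_bounds_of_runs (hL : HistLipschitz Λ γ β) (hΛ : FadingMemory C θ Λ) (hS : ScaleShiftRate c θ γ β)
    (hθ0 : 0 ≤ θ) (hθ1 : θ < 1) (hC : 0 ≤ C) {δ s s' : ℝ} (hδ : 0 < δ) (hδγ : δ ≤ γ) (hs : 0 < s)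
    (hruns : ∀ K : ℕ, ∃ r : ℕ → ℝ, RGEqH K β r ∧ Step.InInterval γ K r ∧ Step.Discrete031 s s' K (r K) r) :
    s - C * δ / (1 - θ) ≤ betaInf β (fun _ : ℕ => δ) ∧ betaInf β (fun _ : ℕ => δ) ≤ s' + C * δ / (1 - θ) := by
  have h1θ : 0 < 1 - θ := by linarith
  have hγ : 0 < γ := hδ.trans_le hδγ
  have hc : 0 ≤ c := constant_nonneg_of_scaleShiftRate hS hγ
  set A : ℝ := 2 * C / ((1 - θ) * Real.sqrt s) with hA
  set B : ℝ := C * γ * θ / (1 - θ) ^ 2 with hB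
  have hA0 : 0 ≤ A := by rw [hA]; positivity
  have hB0 : 0 ≤ B := by rw [hB]; positivity
  set f : ℝ := betaInf β (fun _ : ℕ => δ) with hf
  -- the window sums against N·f, up to N·cθ^k/(1−θ)
  have hwin : ∀ k N : ℕ, |∑ j ∈ Ico k (k + N), β j (fun _ : Fin (j + 1) => δ) - (N : ℝ) * f| ≤ (N : ℝ) * (c * θ ^ k / (1 - θ)) := by
    intro k N
    have hterm : ∀ j ∈ Ico k (k + N), |β j (fun _ : Fin (j + 1) => δ) - f| ≤ c * θ ^ k / (1 - θ) := by
      intro j hj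
      have hkj : k ≤ j := (mem_Ico.mp hj).1
      refine (abs_const_sub_betaInf_le hS hθ1 hδ hδγ j).trans ?_
      exact div_le_div_of_nonneg_right (mul_le_mul_of_nonneg_left (pow_le_pow_of_le_one hθ0 hθ1.le hkj) hc) h1θ.le
    have hsum : ∑ j ∈ Ico k (k + N), (β j (fun _ : Fin (j + 1) => δ) - f) =
        ∑ j ∈ Ico k (k + N), β j (fun _ : Fin (j + 1) => δ) - (N : ℝ) * f := by
      rw [Finset.sum_sub_distrib, Finset.sum_const, Nat.card_Ico, Nat.add_sub_cancel_left, nsmul_eq_mul]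
    rw [← hsum]
    calc |∑ j ∈ Ico k (k + N), (β j (fun _ : Fin (j + 1) => δ) - f)| ≤ ∑ j ∈ Ico k (k + N), |β j (fun _ : Fin (j + 1) => δ) - f| :=
          Finset.abs_sum_le_sum_abs _ _
      _ ≤ ∑ j ∈ Ico k (k + N), c * θ ^ k / (1 - θ) := Finset.sum_le_sum hterm
      _ = (N : ℝ) * (c * θ ^ k / (1 - θ)) := by rw [Finset.sum_const, Nat.card_Ico, Nat.add_sub_cancel_left, nsmul_eq_mul]
  constructor
  · -- lower: s − Cδ/(1−θ) ≤ f + cθ^k/(1−θ) for every k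
    refine le_of_forall_geom (c := c) hθ0 hθ1 fun k => ?_
    refine le_of_sq_windows hA0 hB0 fun M hM1 => ?_
    have hMpos : (0 : ℝ) < M := by exact_mod_cast hM1
    have hlow := (constDrift_of_runs hL hΛ hθ0 hθ1 hC hδ hδγ hs hruns k (M * M)).1
    have hw := (abs_le.mp (hwin k (M * M))).2
    have hsqrt : Real.sqrt ((M * M : ℕ) : ℝ) = M := by rw [Nat.cast_mul, Real.sqrt_mul_self hMpos.le]
    have hMM : ((M * M : ℕ) : ℝ) = (M : ℝ) * M := by push_cast; ring
    rw [hsqrt] at hlow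
    rw [hMM] at hlow hw
    nlinarith [hlow, hw]
  · -- upper: f − cθ^k/(1−θ) ≤ s′ + Cδ/(1−θ) for every k
    have key : ∀ k : ℕ, f ≤ s' + C * δ / (1 - θ) + c * θ ^ k / (1 - θ) := by
      intro k
      have h' : f - c * θ ^ k / (1 - θ) ≤ s' + C * δ / (1 - θ) := by
        refine le_of_sq_windows hA0 hB0 fun M hM1 => ?_
        have hMpos : (0 : ℝ) < M := by exact_mod_cast hM1
        have hup := (constDrift_of_runs hL hΛ hθ0 hθ1 hC hδ hδγ hs hruns k (M * M)).2
        have hw := (abs_le.mp (hwin k (M * M))).1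
        have hsqrt : Real.sqrt ((M * M : ℕ) : ℝ) = M := by rw [Nat.cast_mul, Real.sqrt_mul_self hMpos.le]
        have hMM : ((M * M : ℕ) : ℝ) = (M : ℝ) * M := by push_cast; ring
        rw [hsqrt] at hup
        rw [hMM] at hup hw
        nlinarith [hup, hw]
      linarith
    exact le_of_forall_geom (c := c) hθ0 hθ1 key

/-- **PRINT's TWO CONSTANTS STRADDLE THE ONE NUMBER: `s ≤ b⋆ ≤ s′`.**  Node U2's moduli + NE4 (0 ≤ θ < 1, 0 ≤ C, 0 < γ), `b⋆` the asymptotic constant, and a family of (0.31)-runs in ]0, γ] at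
slopes `0 < s ≤ s′` (one per depth; from the TYPED Theorem 2 at ONE admissible endpoint g₁: `s = β(g₁) ln L`, `s′ = β′(g₁) ln L`, part 10's `runs_of_theorem2`) ⟹ `s ≤ b⋆ ≤ s′`
(`betaInf_const_bounds_of_runs` at every δ, δ → 0⁺).  Consequently the constants the typed (0.31) admits at DIFFERENT endpoints are mutually constrained: every lower slope is ≤ every upper slope.
[cite: Balaban1987RG1, Thm 2 (0.31) p.259 with (0.20) p.256 and §5 p.298] -/
theorem slopes_straddle_bstar (hL : HistLipschitz Λ γ β) (hΛ : FadingMemory C θ Λ) (hS : ScaleShiftRate c θ γ β)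
    (hθ0 : 0 ≤ θ) (hθ1 : θ < 1) (hC : 0 ≤ C) (hγ : 0 < γ) {bstar : ℝ}
    (hb : ∀ u : ℝ, 0 < u → u ≤ γ → |betaInf β (fun _ : ℕ => u) - bstar| ≤ C * u / (1 - θ))
    {s s' : ℝ} (hs : 0 < s)
    (hruns : ∀ K : ℕ, ∃ r : ℕ → ℝ, RGEqH K β r ∧ Step.InInterval γ K r ∧ Step.Discrete031 s s' K (r K) r) :
    s ≤ bstar ∧ bstar ≤ s' := by
  have h1θ : 0 < 1 - θ := by linarith
  have hu : ∀ u : ℝ, 0 < u → u ≤ γ → s - 2 * C * u / (1 - θ) ≤ bstar ∧ bstar ≤ s' + 2 * C * u / (1 - θ) := by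
    intro u hu huγ
    have hf := betaInf_const_bounds_of_runs hL hΛ hS hθ0 hθ1 hC hu huγ hs hruns
    have hb' := abs_le.mp (hb u hu huγ)
    have e : 2 * C * u / (1 - θ) = C * u / (1 - θ) + C * u / (1 - θ) := by ring
    constructor <;> linarith [hf.1, hf.2, hb'.1, hb'.2]
  -- u → 0⁺
  have hsmall : ∀ ε : ℝ, 0 < ε → ∃ u : ℝ, 0 < u ∧ u ≤ γ ∧ 2 * C * u / (1 - θ) ≤ ε := by
    intro ε hε
    refine ⟨min γ (ε * (1 - θ) / (2 * (C + 1))), lt_min hγ (by positivity), min_le_left _ _, ?_⟩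
    set u : ℝ := min γ (ε * (1 - θ) / (2 * (C + 1))) with hudef
    have hu0 : 0 < u := lt_min hγ (by positivity)
    have h1 : u ≤ ε * (1 - θ) / (2 * (C + 1)) := min_le_right _ _
    have h2 : 2 * (C + 1) * u ≤ ε * (1 - θ) := by rwa [le_div_iff₀ (by positivity), mul_comm] at h1
    rw [div_le_iff₀ h1θ]
    nlinarith [hu0.le]
  constructor
  · refine le_of_forall_pos_le_add fun ε hε => ?_
    obtain ⟨u, hu0, huγ, huε⟩ := hsmall ε hε
    linarith [(hu u hu0 huγ).1]
  · refine le_of_forall_pos_le_add fun ε hε => ?_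
    obtain ⟨u, hu0, huγ, huε⟩ := hsmall ε hε
    linarith [(hu u hu0 huγ).2]

/-- In particular a family of (0.31)-runs with a POSITIVE lower slope makes the asymptotic constant positive: `0 < s ≤ b⋆`. [cite: Balaban1987RG1, Thm 2 (0.31) p.259 with (0.20) p.256] -/
theorem bstar_pos_of_runs (hL : HistLipschitz Λ γ β) (hΛ : FadingMemory C θ Λ) (hS : ScaleShiftRate c θ γ β)
    (hθ0 : 0 ≤ θ) (hθ1 : θ < 1) (hC : 0 ≤ C) (hγ : 0 < γ) {bstar : ℝ}
    (hb : ∀ u : ℝ, 0 < u → u ≤ γ → |betaInf β (fun _ : ℕ => u) - bstar| ≤ C * u / (1 - θ))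
    {s s' : ℝ} (hs : 0 < s)
    (hruns : ∀ K : ℕ, ∃ r : ℕ → ℝ, RGEqH K β r ∧ Step.InInterval γ K r ∧ Step.Discrete031 s s' K (r K) r) :
    0 < bstar :=
  hs.trans_le (slopes_straddle_bstar hL hΛ hS hθ0 hθ1 hC hγ hb hs hruns).1

end

end Summit.QuantumFields.BalabanUV.Beta.EriceFlowEnclosureB12AsPrintedPointwiseFadingLimitFloors
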